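import Summits.AnomalousDissipation.AnomalousDissipation.Theses.WindLine
import Summits.AnomalousDissipation.AnomalousDissipation.Theorems.WindLineWindLineFeedsTarget
import Summits.AnomalousDissipation.AnomalousDissipation.Theorems.WindLineCyclicWindLineLoudStubFarShoreOnWindLine

/-!
# `WindNeverLoud → ¬ CyclicWindLineLoud` — the kill criterion of route WindLine as a theorem

Crux `CyclicWindLineLoud` (stmt-AnomalousDissipation-11415, rank 2) and crux `WindNeverLoud`
(stmt-AnomalousDissipation-11417, rank 4) of route WindLine are mutually exclusive: `WindNeverLoud` is the negative
universal of the line ("for every smooth divergence-free mean-zero force, every non-resonant wind direction and every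
`E, ε > 0` there is `ν₀ > 0` such that at EVERY resolution `N` and every `0 < ν < ν₀` every wind-line state of energy
`≤ E` has dissipation `< ε`"), and `CyclicWindLineLoud` asserts loud bounded wind-line states for ONE force (the cyclic
force `(sin 2πx₃, sin 2πx₁, sin 2πx₂)`) and ONE direction (`e = (1, √2, √3)`, non-resonant on `ℤ³ ∖ 0`) along some
`ν_j → 0⁺` at infinitely many `N`. The route text records `WindNeverLoud → ¬CyclicWindLineLoud` as the kill criterion of
the crux; this file proves it (instantiate `WindNeverLoud` at the cyclic force — smooth, divergence free, mean zero —
and the direction `(1, √2, √3)`, whose complexification is the literal `!₂[1, √2, √3] : ℂ³` of the crux; pick `j` with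
`ν_j < ν₀` from `ν_j → 0`, one of the infinitely many resolutions, and the loud bounded wind-line state contradicts
the quiet bound). It is a NEGATIVE-SIDE support of the crux item (a `_false_of_` lemma: the crux fails as soon as the
wind-axis no-anomaly statement holds), not a refutation — `WindNeverLoud` is itself open.
-/

-- `Summit.<Summit>.<Problem>` is the tree's mandated summit-side namespace (CONVENTIONS §2); for this
-- single-conjunct summit the two coincide, so the duplicate is deliberate.
set_option linter.dupNamespace false

noncomputable section

open scoped BigOperators InnerProductSpace ComplexConjugate
open Filter Set Topology

namespace Summit.AnomalousDissipation.AnomalousDissipation.Theorems.CyclicWindLineLoud.Negative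

open Literature.Analysis.FunctionSpaces Literature.Analysis.FunctionSpaces.Torus Literature.Analysis.FluidPDE

/-- **Kill criterion of route WindLine, crux 2**: the wind-axis no-anomaly statement `WindNeverLoud` (crux 4) refutes
`CyclicWindLineLoud` (crux 2). Instantiate `WindNeverLoud` at the cyclic force (smooth, divergence free, mean zero:
`WindLineCyclic.isSmooth_cycForce`, `isDivFree_cycForce`, `hasZeroMean_cycForce`) and the non-resonant direction
`(1, √2, √3)` (`FarShore.windDir_nonresonant`, `FarShore.complexify_windDir`), with the `E, ε` of the crux; choose `j`
with `ν_j < ν₀` (`ν_j → 0`) and one of the infinitely many resolutions `N` the crux serves: the loud bounded wind-line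
state there has dissipation both `≥ ε` and `< ε`. [folklore] -/
theorem CyclicWindLineLoud_false_of_WindNeverLoud :
    Summit.AnomalousDissipation.AnomalousDissipation.Theses.WindLine.WindNeverLoud →
      ¬ Summit.AnomalousDissipation.AnomalousDissipation.Theses.WindLine.CyclicWindLineLoud := by
  intro hW hC
  unfold Summit.AnomalousDissipation.AnomalousDissipation.Theses.WindLine.CyclicWindLineLoud at hC
  unfold Summit.AnomalousDissipation.AnomalousDissipation.Theses.WindLine.WindNeverLoud at hW
  obtain ⟨ν, E, ε, hν, hν0, hε, hX⟩ := hC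
  obtain ⟨ν₀, hν₀, hW⟩ := hW _ WindLineCyclic.isSmooth_cycForce WindLineCyclic.isDivFree_cycForce
    WindLineCyclic.hasZeroMean_cycForce (!₂[(1 : ℝ), Real.sqrt 2, Real.sqrt 3] : EuclideanSpace ℝ (Fin 3))
    FarShore.windDir_nonresonant E ε hε
  rw [FarShore.complexify_windDir] at hW
  -- a viscosity of the sequence below the quiet threshold
  obtain ⟨j, hj⟩ := (hν0.eventually (gt_mem_nhds hν₀)).exists
  -- one of the infinitely many loud resolutions
  obtain ⟨N, hN⟩ := (hX j).exists
  obtain ⟨c, hcV, hwind, hE, hloud⟩ := hN _ rfl _ rfl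
  have hquiet := hW (ν j) N _ (hν j) hj rfl _ rfl c hcV hwind hE
  exact absurd hloud (not_le.2 hquiet)

end Summit.AnomalousDissipation.AnomalousDissipation.Theorems.CyclicWindLineLoud.Negative

end
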